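import Summits.HodgeConjecture.HodgeConjecture.Theorems.CyclicUnitaryPowersFermatGeometricGenusBound

/-!
# Stub `stub_fermatGenusLe` of crux K1-A `VeryGeneralDeckCommutatorsInHg` (line unitary-reflection-zariski, registry v16), PROVED

Prover seat `hodge-nonav-prover-Bx` (g10), cell `hodge-nonav`, crux stmt-HodgeConjecture-19544
(`Summit.HodgeConjecture.HodgeConjecture.Theses.CyclicUnitaryPowers.VeryGeneralDeckCommutatorsInHg`). The registered stub FGle
(skeleton 79e3a6717bb2, planner p3 g30): the geometric genus of the Fermat surface of prime degree `p ≥ 5` is at most `C(p-1, 3)` —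
verbatim the hypothesis `hFermatLe` of `CyclicUnitaryPowersK1OfFermatGenusLe`. It is the theorem
`CyclicUnitaryPowersFermatGeometricGenusBound.hodgeNumber_two_zero_fermat_le` (programme PG-FERMAT, valid for every `p ≥ 4`).
With it the skeleton's composition `VeryGeneralDeckCommutatorsInHg_of` needs only the two named facts F1‡ and CDK
(`CyclicUnitaryPowersFermatGeometricGenusBound.veryGeneralDeckCommutatorsInHg_of_localMonodromyBound_cdk`).

Sorry-free; no definition, no named fact; nothing here says HC ∕ HC_AV is proved (rung F-H1 not moved).
[cite: Shioda1979HodgeFermat, §1 (1.7)]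
-/

noncomputable section

set_option linter.dupNamespace false

namespace Summit.HodgeConjecture.HodgeConjecture.Theorems.CyclicUnitaryPowersVeryGeneralDeckCommutatorsInHgStubFermatGenusLe

/-- **Stub FGle, PROVED**: `h^{2,0}(X²_p) ≤ C(p-1, 3)` for the Fermat surface of every prime degree `p ≥ 5`, on the tree's Hodge
structure `H²(X²_p)` — exactly the registered signature of `stub_fermatGenusLe`
(`CyclicUnitaryPowersFermatGeometricGenusBound.hodgeNumber_two_zero_fermat_le`, which holds for all `p ≥ 4`).
[cite: Shioda1979HodgeFermat, §1 (1.7)] -/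
theorem stub_fermatGenusLe :
    ∀ ⦃p : ℕ⦄, p.Prime → 5 ≤ p → ∀ (hHD : Literature.AlgebraicGeometry.HodgeTheory.exists_isReal_hodgeModel)
      (hX : Literature.AlgebraicGeometry.Motives.IsSmoothProjective 2
        (Literature.AlgebraicGeometry.HodgeTheory.fermatHypersurface 2 p)),
      (Literature.AlgebraicGeometry.HodgeTheory.BettiUniverse.hodge hHD hX 2).hodgeNumber 2 0 ≤ Nat.choose (p - 1) 3 :=
  @fun _ _ h5 hHD hX ↦
    Summit.HodgeConjecture.HodgeConjecture.Theorems.CyclicUnitaryPowersFermatGeometricGenusBound.hodgeNumber_two_zero_fermat_le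
      (by omega) hHD hX

end Summit.HodgeConjecture.HodgeConjecture.Theorems.CyclicUnitaryPowersVeryGeneralDeckCommutatorsInHgStubFermatGenusLe

end
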